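import Summits.KontsevichZagierPeriods.KontsevichZagierPeriods.Theorems.SectorTwoSix.Negative.ScissorsSubcalculus

/-!
# `SectorTwoSix` (stmt-KontsevichZagierPeriods-3870) — negative side, III: among the Newton–Leibniz-free
# sub-calculi only those containing BOTH rule (1b) and rule (2) can prove the crux

Refuter (`cdisprove`, cycle 5) by-product, the common corollary of `Negative/LoadBearing.lean`
(`not_sectorTwoSixAdditive`: rules (1a) + (1b) do not suffice) and `Negative/ScissorsSubcalculus.lean`
(`not_sectorTwoSixScissors`: rules (1a) + (2) do not suffice).  For each of the eight sub-calculi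
generated by a subset `T ⊆ {1a domain additivity, 1b integrand additivity, 2 change of variables}` of the
Newton–Leibniz-free move types (`nlFreeSubcalc a b c`, Booleans selecting the three types), reading the
crux's conclusion with `KZ.relations` replaced by `closure T` (`SectorTwoSixIn (nlFreeSubcalc a b c)`)
IMPLIES `1b ∈ T ∧ 2 ∈ T` (`sectorTwoSixIn_nlFreeSubcalc_imp`, unconditional, by monotonicity in `T`).
The converse under CDT — the conclusion DOES hold inside `closure (integrandAddRel ∪ changeOfVariablesRel)`,
with no domain additivity and no Newton–Leibniz — is the positive content of the crux work file
(`Cruxes/SectorTwoSix/Disproof.lean` §14, `conclusionIn_oneB_two`, a prover's landing), so `{1b, 2}` is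
the EXACT minimal Newton–Leibniz-free move set.  Whether rule (3) could replace rule (2) is the barrier
question `Literature.Barriers.KontsevichZagierPeriods.AlgebraicPrimitivesObstruction` (open either way).

Sources: M. Kontsevich, D. Zagier, *Periods* (2001), §1.2 (the rules).
-/

noncomputable section

open MeasureTheory Set Polynomial
open Literature.NumberTheory.Transcendental Literature.ModelTheory.ExponentialFields

namespace Summit.KontsevichZagierPeriods.Theorems.SectorTwoSix.Negative

/-- The crux's conclusion read in an arbitrary sub-calculus `S` (CDT antecedent dropped): the common
shape of `SectorTwoSixAdditive` and `SectorTwoSixScissors` (a statement variant of this file, not a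
literature fact). -/
def SectorTwoSixIn (S : AddSubgroup KZ.FormalRep) : Prop :=
  ∀ (r r' : KZ.IntegralRep 2) (P P' : ℚ[X]), r.domain = {x | ∀ i, x i ∈ Set.Ioo (0:ℝ) 1} →
    r'.domain = {x | ∀ i, x i ∈ Set.Ioo (0:ℝ) 1} →
    EqOn r.integrand (fun x => Polynomial.aeval (x 0 * x 1) P / (1 - (x 0 * x 1) ^ 6)) r.domain →
    EqOn r'.integrand (fun x => Polynomial.aeval (x 0 * x 1) P' / (1 - (x 0 * x 1) ^ 6)) r'.domain →
    r.value = r'.value → KZ.of r - KZ.of r' ∈ S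

/-- `SectorTwoSixIn` is monotone in the sub-calculus. [folklore] -/
theorem sectorTwoSixIn_mono {S S' : AddSubgroup KZ.FormalRep} (h : S ≤ S') (hS : SectorTwoSixIn S) :
    SectorTwoSixIn S' :=
  fun r r' P P' hd hd' hf hf' hv => h (hS r r' P P' hd hd' hf hf' hv)

/-- The additivity-only sub-crux is `SectorTwoSixIn (closure (1a ∪ 1b))` (`Iff.rfl`). [folklore] -/
theorem sectorTwoSixAdditive_iff :
    SectorTwoSixAdditive ↔ SectorTwoSixIn (AddSubgroup.closure (KZ.domainAddRel ∪ KZ.integrandAddRel)) :=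
  Iff.rfl

/-- The scissors sub-crux is `SectorTwoSixIn (closure (1a ∪ 2))` (`Iff.rfl`). [folklore] -/
theorem sectorTwoSixScissors_iff :
    SectorTwoSixScissors ↔
      SectorTwoSixIn (AddSubgroup.closure (KZ.domainAddRel ∪ KZ.changeOfVariablesRel)) :=
  Iff.rfl

/-- The sub-calculus generated by the selected Newton–Leibniz-free move types: `a` ↦ (1a) domain
additivity, `b` ↦ (1b) integrand additivity, `c` ↦ (2) change of variables. [folklore] -/
def nlFreeSubcalc (a b c : Bool) : AddSubgroup KZ.FormalRep :=
  AddSubgroup.closure ((if a then KZ.domainAddRel else ∅) ∪ (if b then KZ.integrandAddRel else ∅) ∪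
    (if c then KZ.changeOfVariablesRel else ∅))

/-- Without rule (2) the selected sub-calculus lies in the additivity sub-calculus. [folklore] -/
theorem nlFreeSubcalc_le_add (a b : Bool) :
    nlFreeSubcalc a b false ≤ AddSubgroup.closure (KZ.domainAddRel ∪ KZ.integrandAddRel) := by
  refine AddSubgroup.closure_mono ?_
  rintro x ((hx | hx) | hx)
  · cases a
    · simp at hx
    · exact Or.inl hx
  · cases b
    · simp at hx
    · exact Or.inr hx
  · simp at hx

/-- Without rule (1b) the selected sub-calculus lies in the scissors sub-calculus. [folklore] -/
theorem nlFreeSubcalc_le_scissors (a c : Bool) :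
    nlFreeSubcalc a false c ≤ AddSubgroup.closure (KZ.domainAddRel ∪ KZ.changeOfVariablesRel) := by
  refine AddSubgroup.closure_mono ?_
  rintro x ((hx | hx) | hx)
  · cases a
    · simp at hx
    · exact Or.inl hx
  · simp at hx
  · cases c
    · simp at hx
    · exact Or.inr hx

/-- **A Newton–Leibniz-free sub-calculus proving the crux contains both (1b) and (2)** (unconditional;
six of the eight sub-calculi `T ⊆ {1a, 1b, 2}` are thereby excluded, the remaining two — `{1b,2}` and
`{1a,1b,2}` — do prove it under CDT by the crux work file's §14). [folklore] -/
theorem sectorTwoSixIn_nlFreeSubcalc_imp (a b c : Bool) (h : SectorTwoSixIn (nlFreeSubcalc a b c)) :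
    b = true ∧ c = true := by
  cases b
  · exact absurd (sectorTwoSixIn_mono (nlFreeSubcalc_le_scissors a c) h) not_sectorTwoSixScissors
  · cases c
    · exact absurd (sectorTwoSixIn_mono (nlFreeSubcalc_le_add a true) h) not_sectorTwoSixAdditive
    · exact ⟨rfl, rfl⟩

/-- Equivalently: the six deficient sub-calculi are refuted. [folklore] -/
theorem not_sectorTwoSixIn_nlFreeSubcalc (a b c : Bool) (hbc : b = false ∨ c = false) :
    ¬ SectorTwoSixIn (nlFreeSubcalc a b c) := by
  intro h
  obtain ⟨hb, hc⟩ := sectorTwoSixIn_nlFreeSubcalc_imp a b c h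
  rcases hbc with hbc | hbc
  · rw [hb] at hbc; exact Bool.noConfusion hbc
  · rw [hc] at hbc; exact Bool.noConfusion hbc

/-- Domain additivity never helps: adding rule (1a) to a deficient sub-calculus does not rescue it
(the case `a = true` of the previous theorem, spelled out for `{1a, 1b}` and `{1a, 2}`). [folklore] -/
theorem not_sectorTwoSixIn_with_domainAdd :
    ¬ SectorTwoSixIn (nlFreeSubcalc true true false) ∧ ¬ SectorTwoSixIn (nlFreeSubcalc true false true) :=
  ⟨not_sectorTwoSixIn_nlFreeSubcalc true true false (Or.inr rfl),
    not_sectorTwoSixIn_nlFreeSubcalc true false true (Or.inl rfl)⟩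

end Summit.KontsevichZagierPeriods.Theorems.SectorTwoSix.Negative
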